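import Summits.NavierStokesRegularity.NavierStokesRegularity.Theorems.IsotropicBlobPressureAssembly
import HarnessLib

/-!
# IsotropicBlobPressureHessian — plate W2 (centre Hessian) of ROUND-41 «IsotropicBlobPressureLaw» (S-door lane):
# the pressure Hessian and the strain FEED of the zonal pressure at the centre

For `C²` profiles: `D²p(0)(v,w) = 2Φ₀′(0)⟪v,w⟫ + Φ₂(0)·(4v₂w₂ − 2v₀w₀ − 2v₁w₁)` (plate R `fderiv_fderiv_radial_mul_apply`
at `x = 0` ×3; the Hessians of `Z₂` (constant) and `Z₄` (vanishing at `0`) from plate P), hence in the S33/S37 currency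
(`StrainDoors.pressureHess`, `strainFeed`, Sketch45's `(fun _ => u)`, `(fun _ => p)` constant-in-time extension):
`pressureHess (fun _ => p) 0 0 e₃ = 2Φ₀′(0) + 4Φ₂(0)` and, for a field with `curl u 0 = 0`,
`strainFeed (fun _ => u) (fun _ => p) 0 0 e₃ = −(2Φ₀′(0) + 4Φ₂(0))` (= `9/14` on p1's data, `centre_zz_Phi`).
`--supports stmt-NavierStokesRegularity-0056 --as helper`.
HONEST FRAME: calculus bookkeeping for a kinematic slice witness; 0056 `NoTypeII` / NS regularity NOT proved.
-/

set_option linter.dupNamespace false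

open Set Function Filter Topology InnerProductSpace MvPolynomial
open scoped RealInnerProductSpace Laplacian ContDiff

namespace Summit.NavierStokesRegularity.NavierStokesRegularity.Theorems.StrainDoors

namespace IsotropicBlob

open HarmonicShell Literature.Analysis Literature.Analysis.FluidPDE VectorCalculus

noncomputable section

/-! ## The Hessians of the zonal harmonics -/

/-- The second partial derivatives of `Z₂`, as polynomial functions: `∂ⱼ∂ᵢZ₂ = diag(−2,−2,4)`. -/
theorem polyFun_pderiv_pderiv_zonal2 (i j : Fin 3) (x : EuclideanSpace ℝ (Fin 3)) :
    polyFun (pderiv j (pderiv i zonal2)) x = if i = j then (if i = 2 then 4 else -2) else 0 := by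
  fin_cases i <;> fin_cases j <;> simp [pderiv_zonal2, pderiv_X, polyFun_apply]

/-- **The Hessian of `Z₂`** (constant): `D²Z₂(x)(v,w) = 4v₂w₂ − 2v₀w₀ − 2v₁w₁`. -/
theorem fderiv_fderiv_polyFun_zonal2 (x v w : EuclideanSpace ℝ (Fin 3)) :
    fderiv ℝ (fderiv ℝ (polyFun zonal2)) x v w = 4 * v 2 * w 2 - 2 * v 0 * w 0 - 2 * v 1 * w 1 := by
  rw [fderiv_fderiv_polyFun_apply]
  simp only [polyFun_pderiv_pderiv_zonal2, Fin.sum_univ_three]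
  simp
  ring

/-- The second partial derivatives of `Z₄` vanish at the origin (they are quadratic forms). -/
theorem polyFun_pderiv_pderiv_zonal4_zero (i j : Fin 3) :
    polyFun (pderiv j (pderiv i zonal4)) (0 : EuclideanSpace ℝ (Fin 3)) = 0 := by
  fin_cases i <;> fin_cases j <;>
    simp [pderiv_zonal4, pderiv_X, polyFun_apply, Derivation.leibniz, Derivation.leibniz_pow]

/-- **The Hessian of `Z₄` at the origin vanishes.** -/
theorem fderiv_fderiv_polyFun_zonal4_zero (v w : EuclideanSpace ℝ (Fin 3)) :
    fderiv ℝ (fderiv ℝ (polyFun zonal4)) 0 v w = 0 := by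
  rw [fderiv_fderiv_polyFun_apply]
  simp only [polyFun_pderiv_pderiv_zonal4_zero, zero_mul, Finset.sum_const_zero]

/-! ## The Hessian of the zonal pressure at the centre -/

variable {Φ₀ Φ₂ Φ₄ : ℝ → ℝ}

/-- Second derivatives add for `C²` functions (pointwise form). -/
theorem fderiv_fderiv_add_apply {f g : EuclideanSpace ℝ (Fin 3) → ℝ} {x : EuclideanSpace ℝ (Fin 3)}
    (hf : ContDiffAt ℝ 2 f x) (hg : ContDiffAt ℝ 2 g x) (v w : EuclideanSpace ℝ (Fin 3)) :
    fderiv ℝ (fderiv ℝ (f + g)) x v w = fderiv ℝ (fderiv ℝ f) x v w + fderiv ℝ (fderiv ℝ g) x v w := by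
  have h := iteratedFDeriv_add_apply (i := 2) hf hg
  have e1 := iteratedFDeriv_two_apply (𝕜 := ℝ) (f + g) x ![v, w]
  have e2 := iteratedFDeriv_two_apply (𝕜 := ℝ) f x ![v, w]
  have e3 := iteratedFDeriv_two_apply (𝕜 := ℝ) g x ![v, w]
  simp only [Matrix.cons_val_zero, Matrix.cons_val_one] at e1 e2 e3
  rw [← e1, ← e2, ← e3, h]
  rfl

/-- **The centre Hessian of the zonal pressure**:
`D²p(0)(v,w) = 2Φ₀′(0)⟪v,w⟫ + Φ₂(0)(4v₂w₂ − 2v₀w₀ − 2v₁w₁)` (the `Z₄` shell contributes nothing at `0`). -/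
theorem fderiv_fderiv_zonalPressure_zero (h0 : ContDiff ℝ 2 Φ₀) (h2 : ContDiff ℝ 2 Φ₂) (h4 : ContDiff ℝ 2 Φ₄)
    (v w : EuclideanSpace ℝ (Fin 3)) :
    fderiv ℝ (fderiv ℝ (zonalPressure Φ₀ Φ₂ Φ₄)) 0 v w =
      2 * deriv Φ₀ 0 * ⟪v, w⟫ + Φ₂ 0 * (4 * v 2 * w 2 - 2 * v 0 * w 0 - 2 * v 1 * w 1) := by
  have hz : ‖(0 : EuclideanSpace ℝ (Fin 3))‖ ^ 2 = 0 := by simp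
  have hA : ContDiffAt ℝ 2 (fun y : EuclideanSpace ℝ (Fin 3) => Φ₀ (‖y‖ ^ 2) * (fun _ => (1 : ℝ)) y) 0 :=
    contDiffAt_radial_mul (h0.contDiffAt) contDiffAt_const
  have hB : ContDiffAt ℝ 2 (fun y : EuclideanSpace ℝ (Fin 3) => Φ₂ (‖y‖ ^ 2) * polyFun zonal2 y) 0 :=
    contDiffAt_radial_mul (h2.contDiffAt) contDiff_zonal2.contDiffAt
  have hC : ContDiffAt ℝ 2 (fun y : EuclideanSpace ℝ (Fin 3) => Φ₄ (‖y‖ ^ 2) * polyFun zonal4 y) 0 :=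
    contDiffAt_radial_mul (h4.contDiffAt) contDiff_zonal4.contDiffAt
  have hAB : ContDiffAt ℝ 2 ((fun y : EuclideanSpace ℝ (Fin 3) => Φ₀ (‖y‖ ^ 2) * (fun _ => (1 : ℝ)) y) +
      fun y : EuclideanSpace ℝ (Fin 3) => Φ₂ (‖y‖ ^ 2) * polyFun zonal2 y) 0 := hA.add hB
  rw [zonalPressure_eq, fderiv_fderiv_add_apply hAB hC, fderiv_fderiv_add_apply hA hB]
  -- shell by shell at the origin (plate R4)
  have hA' := fderiv_fderiv_radial_mul_apply (g := Φ₀) (h := fun _ : EuclideanSpace ℝ (Fin 3) => (1 : ℝ))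
    (x := 0) (by rw [hz]; exact h0.contDiffAt) contDiffAt_const v w
  have hB' := fderiv_fderiv_radial_mul_apply (g := Φ₂) (h := polyFun zonal2)
    (x := 0) (by rw [hz]; exact h2.contDiffAt) contDiff_zonal2.contDiffAt v w
  have hC' := fderiv_fderiv_radial_mul_apply (g := Φ₄) (h := polyFun zonal4)
    (x := 0) (by rw [hz]; exact h4.contDiffAt) contDiff_zonal4.contDiffAt v w
  rw [hA', hB', hC', hz, fderiv_fderiv_polyFun_zonal2, fderiv_fderiv_polyFun_zonal4_zero, polyFun_zonal2_zero,
    polyFun_zonal4_zero]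
  -- the constant shell: `D(1) = 0`, `D²(1) = 0`
  have hc1 : fderiv ℝ (fun _ : EuclideanSpace ℝ (Fin 3) => (1 : ℝ)) = fun _ => 0 := by
    funext y; exact fderiv_const_apply 1
  have hc2 : fderiv ℝ (fderiv ℝ (fun _ : EuclideanSpace ℝ (Fin 3) => (1 : ℝ))) 0 v w = 0 := by
    rw [hc1]; simp
  have hc4 : ∀ u : EuclideanSpace ℝ (Fin 3), fderiv ℝ (fun _ : EuclideanSpace ℝ (Fin 3) => (1 : ℝ)) 0 u = 0 :=
    fun u => by rw [fderiv_const_apply]; rfl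
  rw [hc2, hc4 v, hc4 w]
  simp only [inner_zero_left, mul_zero, zero_mul, add_zero, zero_add]
  ring

/-- **The centre pressure Hessian in the S33/S37 currency**:
`pressureHess (fun _ => p) 0 0 e = 2Φ₀′(0)‖e‖² + Φ₂(0)(4e₂² − 2e₀² − 2e₁²)`. -/
theorem pressureHess_zonalPressure_zero (h0 : ContDiff ℝ 2 Φ₀) (h2 : ContDiff ℝ 2 Φ₂) (h4 : ContDiff ℝ 2 Φ₄)
    (e : EuclideanSpace ℝ (Fin 3)) :
    pressureHess (fun _ => zonalPressure Φ₀ Φ₂ Φ₄) 0 0 e =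
      2 * deriv Φ₀ 0 * ‖e‖ ^ 2 + Φ₂ 0 * (4 * e 2 * e 2 - 2 * e 0 * e 0 - 2 * e 1 * e 1) := by
  unfold pressureHess
  rw [real_inner_comm, inner_fderiv_gradient_eq_iteratedFDeriv, iteratedFDeriv_two_apply]
  simp only [Matrix.cons_val_zero, Matrix.cons_val_one]
  rw [fderiv_fderiv_zonalPressure_zero h0 h2 h4, real_inner_self_eq_norm_sq]

/-- **The centre pressure Hessian along the symmetry axis**: `∇²p(0)(e₃,e₃) = 2Φ₀′(0) + 4Φ₂(0)`. -/
theorem pressureHess_zonalPressure_zero_axis (h0 : ContDiff ℝ 2 Φ₀) (h2 : ContDiff ℝ 2 Φ₂) (h4 : ContDiff ℝ 2 Φ₄) :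
    pressureHess (fun _ => zonalPressure Φ₀ Φ₂ Φ₄) 0 0 (EuclideanSpace.single 2 1) =
      2 * deriv Φ₀ 0 + 4 * Φ₂ 0 := by
  rw [pressureHess_zonalPressure_zero h0 h2 h4]
  simp
  ring

/-- **The centre strain feed along the axis** for a field with no vorticity at the centre:
`H(0,e₃) = ¼(|ω|² − ω_z²) − ∇²p(e₃,e₃) = −(2Φ₀′(0) + 4Φ₂(0))`. -/
theorem strainFeed_zonalPressure_zero_axis {u : EuclideanSpace ℝ (Fin 3) → EuclideanSpace ℝ (Fin 3)}
    (hcurl : curl u 0 = 0) (h0 : ContDiff ℝ 2 Φ₀) (h2 : ContDiff ℝ 2 Φ₂) (h4 : ContDiff ℝ 2 Φ₄) :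
    strainFeed (fun _ => u) (fun _ => zonalPressure Φ₀ Φ₂ Φ₄) 0 0 (EuclideanSpace.single 2 1) =
      -(2 * deriv Φ₀ 0 + 4 * Φ₂ 0) := by
  unfold strainFeed
  rw [pressureHess_zonalPressure_zero_axis h0 h2 h4]
  simp [hcurl]

end

end IsotropicBlob

end Summit.NavierStokesRegularity.NavierStokesRegularity.Theorems.StrainDoors
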